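import Summits.BirchSwinnertonDyer.BirchSwinnertonDyer.Theorems.SignedLowerHalvesKobayashiLowerHalfLargeImageBSTWTwistConsumers
import Literature.NumberTheory.EllipticCurves.JetchevSkinnerWan2017.RankZeroTwistSupersingularPPartOPEN
import Literature.NumberTheory.EllipticCurves.Rank1Residual.PrintShapeTorsion
import Literature.NumberTheory.EllipticCurves.Rank1Residual.Dedup
import Literature.NumberTheory.EllipticCurves.AnalyticRankOrderProofs
import HarnessLib

/-!
# Route `SignedLowerHalves`, crux `KobayashiLowerHalfLargeImage` (item stmt-BirchSwinnertonDyer-19001): the BSTW-TWIST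
# SUB-FAMILY of class X7 — a SECOND ROAD for its RANK-ZERO pairs: the class-wide consumer of a twist datum on the
# REFEREED twist sentence Jetchev–Skinner–Wan 2017 Thm. 7.2.1 (iii) (cell `pub/bsd-litref`, paper sub-dir `bstw24`, prover seat
# `bsd-litref-bstw24-pv` gen 6; companion of `…BSTWTwistConsumers.lean` p496619; `--supports … --as helper`; THEOREMS ONLY; closes nothing)

HONEST FRAMING (programme BSD-LIT2PART v1 §HONESTY, verbatim): «no tranche here proves BSD; ARM L moves the LITERAL column of an r ≤ 1
census into the kernel-proved-modulo-named-print column; ARM P changes what "named print" is worth.» Jetchev–Skinner–Wan, Camb. J. Math. 5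
(2017) Thm. 7.2.1 (iii) with Rem. 7.2.2 (the rank-`0` `p`-part of BSD for the quadratic twists `E^{D″}`, `(D″, Np) = 1`, of a semistable `E`
at a supersingular `p ≥ 3`; BODY-form wording, NO ordinarity proviso) is REFEREED PRINT, but its supersingular case rests on the withdrawn [W]
(Wan's `±`-main conjecture) and hence, today, on the BSTW preprint (Rem. 10.3 (ii)); referee C ROUND 353 (δ) words it GAP(line)
`JSW17-7.2.1(iii)-twist@BSTW-III-2.2(unrefereed, intro/body-inconsistent)`. It enters ONLY as the tree's explicitly labelled OPEN binder
`Literature.NumberTheory.EllipticCurves.JetchevSkinnerWan2017.thm721iii_twist_padicValRat_bsd_rank_zero_OPEN` (p459674), taken as a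
HYPOTHESIS — never as a theorem. Closes nothing; class X7 stays CONSTRUCTION-SHAPED; crux 3 stays OPEN; the desk words any tier.

WHAT. `bsdp_of_thm721iii_twist_OPEN_of_twistBody` — from a BODY twist datum of the records (`twist_x7bstw_<label>_<p>`: `W₀` semistable,
`p` good supersingular for `W₀` with `a_p(W₀) = 0`, `d` square-free `≠ 1`, ramified primes of `ℚ(√d)` `≠ p` and good for `W₀`,
`C • W = W₀^{(d)}`), `3 ≤ p`, the pair's analytic rank `0` (DATA), modularity `hmod` and GZK `hGZK` (PUBLISHED, by name): `BSDp W p` modulo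
the JSW binder. Dictionary: `Semistable ↔ IsSemistable (𝓞 ℚ)` (`semistable_iff_isSemistable_ringOfIntegers`); `ℓ ∣ d ⇒` ramified; `d ≢ 1
(mod 4) ⇒ 2` ramified; `a_p(W) = (d/p)·a_p(W₀) = 0` (`frobeniusTrace_of_smul_eq_quadraticTwist`); `E^K[p]` irreducible from the twist's
supersingularity (Serre 1972); `L(E^K,1) ≠ 0` from `r_an = 0` (`analyticRank_eq_zero_iff_holds`); `Ш` finite from GZK; the rank-`0` print
shape with torsion ⇒ `BSDp` (`pPart_of_pPartRankZero`, `bsdp_of_pPart`). An INTRO datum is a BODY datum (`twistBody_of_twistIntro`), so every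
rank-`0` record pair (82 of the 415: 64 INTRO + 18 BODY-only) is reached. Design: THEOREMS ONLY; default heartbeats; axioms standard.

References: [JetchevSkinnerWan2017] Camb. J. Math. 5 (2017) Thm. 7.2.1 (iii), Rem. 7.2.2; [BurungaleSkinnerTianWan2024] Rem. 10.3 (ii);
[Serre1972] §1.11 Prop. 12; [Knapp1993] Prop. 12.10; [Miller2011LMS] §1, Def. 1.1; [Darmon2004] Thm. 3.22.
-/

set_option autoImplicit false
set_option linter.dupNamespace false

noncomputable section

open scoped Classical NumberField

open WeierstrassCurve Literature.NumberTheory.EllipticCurves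
  Literature.NumberTheory.EllipticCurves.Rank1Residual
  Literature.NumberTheory.EllipticCurves.BurungaleSkinnerTianWan2024
  Literature.NumberTheory.EllipticCurves.JetchevSkinnerWan2017
  Summit.BirchSwinnertonDyer.Rank1Residual.Supersingular

namespace Summit.BirchSwinnertonDyer.BirchSwinnertonDyer.Theorems.X7Twist

variable (W : WeierstrassCurve ℚ) [W.IsElliptic] [W.IsGloballyMinimal] (p : ℕ) [Fact p.Prime]

/-- **`BSD(E, p)` at a RANK-ZERO twist pair from a BODY twist datum, CONDITIONAL on Jetchev–Skinner–Wan 2017 Thm. 7.2.1 (iii)'s twist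
sentence** (binder `thm721iii_twist_padicValRat_bsd_rank_zero_OPEN`, refereed print resting on the withdrawn [W] / the BSTW preprint — an explicit
hypothesis, never a theorem) + modularity `hmod` + GZK `hGZK` (PUBLISHED, by name) + the DATA `r_an(W) = 0`. Closes nothing; X7 stays
CONSTRUCTION-SHAPED. [claim: BurungaleSkinnerTianWan2024, status: under-review]
[cite: JetchevSkinnerWan2017, Thm. 7.2.1 (iii) with Rem. 7.2.2 (twist clause; OPEN binder)] [cite: Serre1972, §1.11 Prop. 12]
[cite: Knapp1993, Prop. 12.10] [cite: Miller2011LMS, §1 and Def. 1.1] [cite: Darmon2004, Thm. 3.22] -/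
theorem bsdp_of_thm721iii_twist_OPEN_of_twistBody (hJSW : thm721iii_twist_padicValRat_bsd_rank_zero_OPEN)
    (hmod : hasEntireLFunction_rat) (hGZK : rank_eq_analyticRank_of_analyticRank_le_one) (hp3 : 3 ≤ p)
    (htw : ∃ (W₀ : WeierstrassCurve ℚ) (_ : W₀.IsElliptic) (_ : W₀.IsGloballyMinimal) (d : ℤ) (C : VariableChange ℚ),
      Semistable W₀ ∧ GoodSS W₀ p ∧ W₀.frobeniusTrace p = 0 ∧ Squarefree d ∧ d ≠ 1 ∧
      (∀ (q : ℕ) [Fact q.Prime], RamifiedInQuadratic d q → q ≠ p ∧ W₀.HasGoodReductionAtPrime q) ∧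
      C • W = W₀.quadraticTwist (d : ℚ))
    (hr : W.analyticRank = 0) : BSDp W p := by
  have hp2 : p ≠ 2 := by omega
  have hG := goodSS_of_twistBody W p hp2 htw
  obtain ⟨W₀, _, _, d, C, hsst, hss, hap₀, hd, hd1, hram, hC⟩ := htw
  -- the dictionary to JSW's hypothesis list
  have hsst' : W₀.IsSemistable (𝓞 ℚ) := (semistable_iff_isSemistable_ringOfIntegers W₀).mp hsst
  have hdN : ∀ (ℓ : ℕ) [Fact ℓ.Prime], (ℓ : ℤ) ∣ d → W₀.HasGoodReductionAtPrime ℓ ∧ ℓ ≠ p := by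
    intro ℓ _ h
    obtain ⟨hℓp, hgood⟩ := hram ℓ (Or.inl h)
    exact ⟨hgood, hℓp⟩
  haveI : Fact (Nat.Prime 2) := ⟨Nat.prime_two⟩
  have hd2 : ¬ d ≡ 1 [ZMOD 4] → W₀.HasGoodReductionAtPrime 2 ∧ p ≠ 2 := by
    intro hmod4
    have hd4 : d % 4 ≠ 1 := by
      intro h; exact hmod4 (by rw [Int.ModEq, h]; norm_num)
    exact ⟨(hram 2 (Or.inr ⟨rfl, hd4⟩)).2, hp2⟩
  have hp2d : ¬ (p : ℤ) ∣ 2 * d := by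
    intro h
    have hpP : p.Prime := Fact.out
    have hpZ : Prime (p : ℤ) := Nat.prime_iff_prime_int.mp hpP
    rcases hpZ.dvd_or_dvd h with h2 | hdvd
    · have : p ∣ 2 := by exact_mod_cast h2
      exact hp2 ((Nat.prime_dvd_prime_iff_eq hpP Nat.prime_two).mp this)
    · exact (hram p (Or.inl hdvd)).1 rfl
  have hap : W.frobeniusTrace p = 0 := by
    rw [frobeniusTrace_of_smul_eq_quadraticTwist W₀ W p hd hC hp2d hss.1, hap₀, mul_zero]
  have hirr : Irr W p :=
    hasIrreducibleModPGaloisRep_of_dvd_frobeniusTrace W p hp2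
      (W.not_dvd_minimalDiscriminantInt_of_hasGoodReductionAtPrime' p hG.1) hG.2
  have hL : W.entireLFunction 1 ≠ 0 := (analyticRank_eq_zero_iff_holds (W := W) (hmod W)).mp hr
  have hfin : Finite W.sha := (hGZK W (by omega)).2
  have hPP : PPartRankZero W p :=
    hJSW W₀ W d C hC hd p hp3 hsst' hdN hd2 hG.1 hap hirr hL hfin
  exact bsdp_of_pPart W p hmod hGZK (by omega) (pPart_of_pPartRankZero W p hGZK hr hPP)

/-- The same from an INTRO datum (bookkeeping through `twistBody_of_twistIntro`). Closes nothing.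
[claim: BurungaleSkinnerTianWan2024, status: under-review] [cite: JetchevSkinnerWan2017, Thm. 7.2.1 (iii) with Rem. 7.2.2 (twist clause; OPEN binder)] -/
theorem bsdp_of_thm721iii_twist_OPEN_of_twistIntro (hJSW : thm721iii_twist_padicValRat_bsd_rank_zero_OPEN)
    (hmod : hasEntireLFunction_rat) (hGZK : rank_eq_analyticRank_of_analyticRank_le_one) (hp3 : 3 ≤ p)
    (htw : ∃ (W₀ : WeierstrassCurve ℚ) (_ : W₀.IsElliptic) (_ : W₀.IsGloballyMinimal) (d : ℤ) (C : VariableChange ℚ),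
      Semistable W₀ ∧ GoodSS W₀ p ∧ W₀.frobeniusTrace p = 0 ∧ Squarefree d ∧ d ≠ 1 ∧
      (∀ (q : ℕ) [Fact q.Prime], RamifiedInQuadratic d q → q ≠ p ∧ GoodOrd W₀ q) ∧
      C • W = W₀.quadraticTwist (d : ℚ))
    (hr : W.analyticRank = 0) : BSDp W p :=
  bsdp_of_thm721iii_twist_OPEN_of_twistBody W p hJSW hmod hGZK hp3 (twistBody_of_twistIntro W p htw) hr

end Summit.BirchSwinnertonDyer.BirchSwinnertonDyer.Theorems.X7Twist

end
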